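import Summits.KontsevichZagierPeriods.KontsevichZagierPeriods.Theses.Grothendieck
import Summits.KontsevichZagierPeriods.KontsevichZagierPeriods.Theorems.ReducedPeriodRing.Negative.SpecHalves
import Summits.KontsevichZagierPeriods.KontsevichZagierPeriods.Theorems.GrothendieckGpcLegendreLemniscatic
import Summits.KontsevichZagierPeriods.KontsevichZagierPeriods.Theorems.GrothendieckGpcZeta4Eq4zeta31
import Summits.KontsevichZagierPeriods.KontsevichZagierPeriods.Theorems.GrothendieckKEAlgIndependent
import Summits.KontsevichZagierPeriods.KontsevichZagierPeriods.Theorems.GrothendieckLemniscaticSectorGlue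
import Literature.NumberTheory.Transcendental.KZKernelConjectureForms
import Literature.NumberTheory.Transcendental.KZRulesAssociator

/-!
# `SectorComplement` (stmt-KontsevichZagierPeriods-11102, route Grothendieck) — the generic-point split

Crux workfile copy (planner, crux-strategist r1, 2026-08-17; `set_option linter.dupNamespace false`: the
Cruxes namespace repeats the summit name by convention). The Theorems-targeted original
`GrothendieckSectorComplementSplit.lean` (namespace `Summit.KontsevichZagierPeriods.Grothendieck.SectorComplementSplit`,
identical statements and proofs) is attached as evidence on stmt-11102 and on the glue item of the
split for a prover to land verbatim (Theorems/ is prover-only, D-0016).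

The declared remainder `SectorComplement := LemniscaticSectorKernel → GpcZeta4Eq4zeta31 →
KontsevichZagierPeriods` of route Grothendieck has both antecedents proved in the tree, so it is
the summit on the nose (`sectorComplement_iff_summit`). This file lands the GLUE of its
decomposition into three statements about the formal period ring `P = KZ.FormalPeriodRing =
FormalRep ⧸ relations` of the calculus (`Literature/NumberTheory/Transcendental/KZRulesAssociator.lean`;
evaluation `evalP : P →+* ℝ`, real-period point `𝔨 := ker evalP`, a prime ideal since
`P ⧸ 𝔨 ↪ ℝ`), none of which mentions representations, values of pairs, endpoints or
`KZ.Equivalent`: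

* **GEN** (route decl `GenericRealPoint`) — every formal period of value `0` is annihilated, after
  raising to a power, by a formal period of NON-ZERO value:
  `∀ x : P, evalP x = 0 → ∃ u, evalP u ≠ 0 ∧ ∃ n, u * x ^ n = 0`.
  Equivalently (`gen_iff_isMinimalPrime`) `𝔨` is a MINIMAL prime of `P`: the real-period point of
  `Spec P` is a generic point — the rules-side form of Grothendieck's NUMERIC period conjecture
  ("`ev` is a generic point of the torsor", `trdeg = dim`; Huber–Müller-Stach 2017 §13.2, André
  2004 §7.5, §23.1), as opposed to Kontsevich's injectivity form, which is the summit.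
* **CAN** (route decl `NonzeroPeriodCancellation`) — formal periods of non-zero value are
  non-zero-divisors: `∀ u x : P, evalP u ≠ 0 → u * x = 0 → x = 0`, i.e. `P` embeds in its local
  ring `P_𝔨` at the real point (its `[π]`-instance is AyoubSpecialisation's `AyoubPiCancellation`
  stmt-0540; its failure in witness form is Neg's `CancellationGap` stmt-11011).
* **RED** — `P` has no nilpotents, `∀ c : FormalRep, c * c ∈ relations → c ∈ relations`: the
  rank-3 crux `ReducedPeriodRing` (stmt-3929) of route FurushoPentagon, shared verbatim.

The three pieces are written OUT as terms throughout (local notations `GEN`, `CAN`; `RED` is the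
FurushoPentagon decl), so that this file introduces no definition and the glue matches the route
file's rendering of the children up to unfolding.

## What is proved

1. `sectorComplement_of_pieces : GEN → CAN → RED → SectorComplement` (THE GLUE), through
   `summit_of_pieces`: for two `ℚ`-rational representations of equal value, `x = ⟦[r] − [r']⟧` has
   value `0`; GEN gives `u · xⁿ = 0` with `evalP u ≠ 0`; CAN cancels `u`; RED (as `IsReduced P`,
   landed `reducedPeriodRing_iff_isReduced`) kills the nilpotent; `⟦[r] − [r']⟧ = 0` is
   `[r] − [r'] ∈ relations`. In `Spec` language GEN ∧ CAN is exactly the irreducibility half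
   `KernelIsNil` of `Negative/SpecHalves.lean` (`kernelIsNil_of_gen_of_can`).
2. Tightness: the summit implies each piece (`gen_of_summit`, `can_of_summit`, `red_of_summit`);
   `summit_iff_pieces`, `sectorComplement_iff_pieces`: the family loses nothing.
3. `gen_iff_isMinimalPrime : GEN ↔ IsMinimalPrime (ker evalP)` (a prime avoiding the
   multiplicative set generated by `P ∖ 𝔨` and `x`, `Ideal.exists_le_prime_disjoint`).
4. `gen_of_algebraicKernel`: André's one-element numeric form "every value-zero formal period is
   algebraic over `ℤ` inside `P`" implies GEN (annihilating polynomial `Xᵏ·q`, `q(0) ≠ 0`, `u = q(x)`),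
   so GEN is the weaker, generic-point form of the Krull squeeze `IsDomain P ∧ AlgebraicKernel`;
   `can_of_isDomain`, `isDomain_of_pieces`: CAN ∧ RED is what integrality contributes beyond GEN.
5. Each piece is load-bearing — abstract models with a surjective evaluation of NON-ZERO kernel
   satisfying two pieces and not the third: `polynomial_model` (`ℚ[t]`, `ev₀`: CAN, RED, not GEN),
   `product_model` (`ℚ × ℚ`, `fst`: GEN, RED, not CAN), `dualNumber_model` (`ℚ[ε]`: GEN, CAN, not
   RED).

References: M. Kontsevich, D. Zagier, *Periods* (2001), §1.2 Conjecture 1, §4.1 (algebra of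
effective periods, Fubini product); A. Huber, S. Müller-Stach, *Periods and Nori Motives* (2017),
§13.2 (period conjecture = "`ev` generic point and torsor connected", Prop. 13.2.6); Y. André,
*Une introduction aux motifs* (2004), §7.5, §23.1 (`trdeg = dim`); J. Ayoub, *Periods and the
conjectures of Grothendieck and Kontsevich–Zagier* (2014), §3.
-/

noncomputable section

set_option linter.dupNamespace false

namespace Summit.KontsevichZagierPeriods.KontsevichZagierPeriods.Cruxes.SectorComplement.StrategistR1

open Literature.NumberTheory.Transcendental KZ
open Summit.KontsevichZagierPeriods.KontsevichZagierPeriods.Theses.Grothendieck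
  (SectorComplement LemniscaticSectorKernel GpcZeta4Eq4zeta31)
open Summit.KontsevichZagierPeriods.KontsevichZagierPeriods.Theses.FurushoPentagon (ReducedPeriodRing)
open Summit.KontsevichZagierPeriods.KontsevichZagierPeriods.ReducedPeriodRingNegative
  (kzKernelConjecture_iff_kernelIsNil_and_reduced summit_iff_kernelIsNil_and_reduced
    kzKernelConjecture_iff_injective_evalP reducedPeriodRing_iff_isReduced)
open Summit.KontsevichZagierPeriods.Grothendieck (gpcZeta4Eq4zeta31_proof keAlgIndependent_proof)
open Summit.KontsevichZagierPeriods.Grothendieck.LemniscaticSectorGlue (lemniscaticSectorGlue_proof)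
open Summit.KontsevichZagierPeriods.Grothendieck.GpcLegendreLemniscaticLine (GpcLegendreLemniscatic_proof)

/-! ## The three pieces (terms, not definitions) -/

set_option quotPrecheck false in
/-- GEN — the real-period point is generic (route decl `Grothendieck.GenericRealPoint`). -/
local notation "GEN" =>
  ∀ x : FormalPeriodRing, evalP x = 0 → ∃ u : FormalPeriodRing, evalP u ≠ 0 ∧ ∃ n : ℕ, u * x ^ n = 0

set_option quotPrecheck false in
/-- CAN — cancellation of non-zero periods (route decl `Grothendieck.NonzeroPeriodCancellation`). -/
local notation "CAN" => ∀ u x : FormalPeriodRing, evalP u ≠ 0 → u * x = 0 → x = 0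

/-! RED is `Theses.FurushoPentagon.ReducedPeriodRing` (stmt-3929):
`∀ c : FormalRep, c * c ∈ relations → c ∈ relations`. -/

/-! ## 1. The glue -/

/-- The summit is the kernel form of Conjecture 1 for the calculus. [folklore] -/
theorem kernel_of_summit (h : KontsevichZagierPeriods) : KZKernelConjecture :=
  kzKernelConjecture_iff_isRational.mpr (KontsevichZagierPeriods_iff.mp h)

/-- **GEN ∧ CAN ⇒ every value-zero class is nilpotent** (the irreducibility half `KernelIsNil` of
`Negative/SpecHalves.lean`): `u · ⟦c⟧ⁿ = 0` with `evalP u ≠ 0`, and `u` cancels. [folklore] -/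
theorem kernelIsNil_of_gen_of_can (hG : GEN) (hC : CAN) :
    ∀ c : FormalRep, eval c = 0 → IsNilpotent (toFormalPeriod c) := by
  intro c hc
  obtain ⟨u, hu, n, hn⟩ := hG (toFormalPeriod c) (by rw [evalP_toFormalPeriod]; exact hc)
  exact ⟨n, hC u _ hu hn⟩

/-- **GEN ∧ CAN ∧ RED ⇒ the kernel conjecture** (a nilpotent class of a reduced ring is `0`;
landed `kzKernelConjecture_iff_kernelIsNil_and_reduced`). [folklore] -/
theorem kzKernelConjecture_of_pieces (hG : GEN) (hC : CAN) (hR : ReducedPeriodRing) :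
    KZKernelConjecture :=
  kzKernelConjecture_iff_kernelIsNil_and_reduced.mpr ⟨kernelIsNil_of_gen_of_can hG hC, hR⟩

/-- **GEN ∧ CAN ∧ RED ⇒ Conjecture 1** (Kontsevich–Zagier 2001, §1.2), spelled out: two
`ℚ`-rational representations `r`, `r'` of equal value give the value-zero class
`x = ⟦[r] − [r']⟧`; GEN produces `u`, `k` with `u · xᵏ = 0`, `evalP u ≠ 0`; CAN gives `xᵏ = 0`;
RED (as `IsReduced P`) gives `x = 0`, i.e. `[r] − [r'] ∈ relations`.
[cite: KontsevichZagier2001, §1.2 Conjecture 1] -/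
theorem summit_of_pieces (hG : GEN) (hC : CAN) (hR : ReducedPeriodRing) : KontsevichZagierPeriods := by
  refine KontsevichZagierPeriods_iff.mpr fun n m r r' _ _ hv => ?_
  -- the value-zero class of the pair
  set c : FormalRep := of r - of r' with hc
  have hval : eval c = 0 := by rw [hc, map_sub, eval_of, eval_of, hv, sub_self]
  -- GEN: an annihilator of non-zero value, after a power
  obtain ⟨u, hu, k, hk⟩ := hG (toFormalPeriod c) (by rw [evalP_toFormalPeriod]; exact hval)
  -- CAN: the annihilator cancels
  have hpow : toFormalPeriod c ^ k = 0 := hC u _ hu hk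
  -- RED: no nilpotents
  have hzero : toFormalPeriod c = 0 :=
    (reducedPeriodRing_iff_isReduced.mp hR).eq_zero _ ⟨k, hpow⟩
  -- back to the calculus: `[r] − [r'] ∈ relations`
  exact toFormalPeriod_eq_zero_iff.mp hzero

/-- **THE GLUE of the split of `SectorComplement`** (stmt-11102): GEN → CAN → RED →
`SectorComplement`. The two antecedents of `SectorComplement` (the lemniscatic sector kernel and
`ζ(4) = 4ζ(3,1)` in the calculus) are not used — they are theorems of the tree.
[cite: KontsevichZagier2001, §1.2 Conjecture 1] -/
theorem sectorComplement_of_pieces (hG : GEN) (hC : CAN) (hR : ReducedPeriodRing) :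
    SectorComplement :=
  fun _ _ => summit_of_pieces hG hC hR

/-! ## 2. Tightness: the summit implies each piece -/

/-- Summit ⇒ GEN (with `u = 1`, `n = 1`). [folklore] -/
theorem gen_of_summit (h : KontsevichZagierPeriods) : GEN := by
  intro x hx
  refine ⟨1, by rw [map_one]; exact one_ne_zero, 1, ?_⟩
  rw [one_mul, pow_one]
  exact kzKernelConjecture_iff_injective_evalP.mp (kernel_of_summit h) (by rw [hx, map_zero])

/-- Summit ⇒ CAN (`evalP` is injective into the domain `ℝ`). [folklore] -/
theorem can_of_summit (h : KontsevichZagierPeriods) : CAN := by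
  intro u x hu hux
  have hinj := kzKernelConjecture_iff_injective_evalP.mp (kernel_of_summit h)
  have h0 : evalP u * evalP x = 0 := by rw [← map_mul, hux, map_zero]
  rcases mul_eq_zero.mp h0 with h1 | h1
  · exact absurd h1 hu
  · exact hinj (by rw [h1, map_zero])

/-- Summit ⇒ RED (landed: `summit_iff_kernelIsNil_and_reduced`). [folklore] -/
theorem red_of_summit (h : KontsevichZagierPeriods) : ReducedPeriodRing :=
  (summit_iff_kernelIsNil_and_reduced.mp h).2

/-- **The split is tight**: Conjecture 1 for the calculus ⟺ GEN ∧ CAN ∧ RED. [folklore] -/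
theorem summit_iff_pieces : KontsevichZagierPeriods ↔ GEN ∧ CAN ∧ ReducedPeriodRing :=
  ⟨fun h => ⟨gen_of_summit h, can_of_summit h, red_of_summit h⟩,
    fun h => summit_of_pieces h.1 h.2.1 h.2.2⟩

/-- Both antecedents of `SectorComplement` are tree theorems (0280 + 8611 + 8612; 0275), so the
item is the summit … [folklore] -/
theorem sectorComplement_iff_summit : SectorComplement ↔ KontsevichZagierPeriods :=
  ⟨fun h => h (lemniscaticSectorGlue_proof keAlgIndependent_proof GpcLegendreLemniscatic_proof)
    gpcZeta4Eq4zeta31_proof, fun h _ _ => h⟩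

/-- … hence ⟺ the conjunction of its three pieces: the family loses nothing. [folklore] -/
theorem sectorComplement_iff_pieces : SectorComplement ↔ GEN ∧ CAN ∧ ReducedPeriodRing :=
  sectorComplement_iff_summit.trans summit_iff_pieces

/-! ## 3. GEN says: the real-period point of `Spec P` is a generic point -/

/-- **GEN ⟺ `ker evalP` is a minimal prime of `P`.** (→) a prime `q ≤ 𝔨` contains `u · xⁿ = 0`
with `u ∉ q`, hence `x`; (←) if no `u · xⁿ` vanishes, a prime ideal avoiding the multiplicative set
generated by `P ∖ 𝔨` and `x` (`Ideal.exists_le_prime_disjoint`) lies inside `𝔨` and misses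
`x ∈ 𝔨`, contradicting minimality. [folklore] -/
theorem gen_iff_isMinimalPrime : GEN ↔ IsMinimalPrime (RingHom.ker evalP) := by
  rw [IsMinimalPrime.iff_minimal]
  constructor
  · intro hG
    refine ⟨RingHom.ker_isPrime evalP, fun q hq hqk => ?_⟩
    intro x hx
    obtain ⟨u, hu, n, hn⟩ := hG x (RingHom.mem_ker.mp hx)
    have huq : u ∉ q := fun h => hu (RingHom.mem_ker.mp (hqk h))
    have hmem : u * x ^ n ∈ q := by rw [hn]; exact q.zero_mem
    rcases hq.mem_or_mem hmem with h | h
    · exact absurd h huq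
    · exact hq.mem_of_pow_mem n h
  · rintro ⟨-, hmin⟩ x hx
    by_contra hcon
    push Not at hcon
    haveI : (RingHom.ker evalP).IsPrime := RingHom.ker_isPrime evalP
    let S : Submonoid FormalPeriodRing := (RingHom.ker evalP).primeCompl ⊔ Submonoid.powers x
    have hdisj : Disjoint ((⊥ : Ideal FormalPeriodRing) : Set FormalPeriodRing)
        (S : Set FormalPeriodRing) := by
      rw [Set.disjoint_left]
      intro z hz hzS
      have hz0 : z = 0 := by simpa using hz
      obtain ⟨u, hu, w, hw, huw⟩ := Submonoid.mem_sup.mp hzS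
      obtain ⟨n, rfl⟩ := hw
      have hu' : evalP u ≠ 0 := fun h0 => (Ideal.mem_primeCompl_iff.mp hu) (RingHom.mem_ker.mpr h0)
      exact hcon u hu' n (huw.trans hz0)
    obtain ⟨q, hq, -, hqS⟩ := Ideal.exists_le_prime_disjoint (⊥ : Ideal FormalPeriodRing) S hdisj
    have hqk : q ≤ RingHom.ker evalP := by
      intro z hz
      by_contra hzk
      exact Set.disjoint_left.mp hqS hz
        (Submonoid.mem_sup_left (Ideal.mem_primeCompl_iff.mpr hzk))
    have hxq : x ∉ q := fun h =>
      Set.disjoint_left.mp hqS h (Submonoid.mem_sup_right (Submonoid.mem_powers x))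
    exact hxq (hmin hq hqk (RingHom.mem_ker.mpr hx))

/-! ## 4. GEN is the generic-point (weak) form of the numeric period conjecture -/

/-- `evalP` commutes with integer polynomial evaluation. [folklore] -/
theorem evalP_aeval_int (c : FormalPeriodRing) (p : Polynomial ℤ) :
    evalP (Polynomial.aeval c p) = Polynomial.aeval (evalP c) p := by
  rw [Polynomial.aeval_def, Polynomial.aeval_def, Polynomial.hom_eval₂]
  congr 1
  ext n
  simp

/-- **André's one-element numeric form implies GEN**: if every value-zero formal period is
algebraic over `ℤ` inside `P`, write its annihilating polynomial as `Xᵏ · q` with `q(0) ≠ 0`;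
then `u = q(x)` has value `q(0) ≠ 0` and `u · xᵏ = 0`. (So GEN is implied by "`dim = trdeg`" on
one-generator subrings, and the Krull squeeze `IsDomain P ∧ AlgebraicKernel` of the crux workfile
refines into the present split; the converse fails abstractly: `ℚ[c, u]/(uc)`.)
[cite: Andre2004, §23.1] -/
theorem gen_of_algebraicKernel (hA : ∀ x : FormalPeriodRing, evalP x = 0 → IsAlgebraic ℤ x) :
    GEN := by
  intro x hx
  obtain ⟨p, hp, hpx⟩ := hA x hx
  obtain ⟨q, hq, hndvd⟩ := Polynomial.exists_eq_pow_rootMultiplicity_mul_and_not_dvd p hp 0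
  rw [map_zero, sub_zero] at hq hndvd
  refine ⟨Polynomial.aeval x q, ?_, p.rootMultiplicity 0, ?_⟩
  · rw [evalP_aeval_int, hx, Polynomial.aeval_def, Polynomial.eval₂_at_zero, eq_intCast,
      Int.cast_ne_zero]
    intro h0
    apply hndvd
    rw [Polynomial.X_dvd_iff]
    exact h0
  · have h1 : Polynomial.aeval x p = Polynomial.aeval x q * x ^ p.rootMultiplicity 0 := by
      conv_lhs => rw [hq]
      rw [map_mul, map_pow, Polynomial.aeval_X, mul_comm]
    rw [← h1, hpx]

/-- Integrality of `P` gives CAN: what the torsor-connectedness half contributes beyond RED.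
[folklore] -/
theorem can_of_isDomain (h : IsDomain FormalPeriodRing) : CAN := by
  intro u x hu hux
  have hu0 : u ≠ 0 := fun h0 => hu (by rw [h0, map_zero])
  exact (mul_eq_zero.mp hux).resolve_left hu0

/-- Conversely GEN ∧ CAN ∧ RED make `P` a domain (indeed a subring of `ℝ`). [folklore] -/
theorem isDomain_of_pieces (hG : GEN) (hC : CAN) (hR : ReducedPeriodRing) :
    IsDomain FormalPeriodRing :=
  (kzKernelConjecture_iff_injective_evalP.mp (kzKernelConjecture_of_pieces hG hC hR)).isDomain evalP

/-! ## 5. Each piece is load-bearing: abstract models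

A commutative ring `R` with a surjective evaluation `ev : R →+* ℚ` whose kernel is NON-ZERO (so the
analogue of Conjecture 1 fails), satisfying two of the three pieces and not the third. -/

/-- **GEN is load-bearing**: `ℚ[t]` with `ev` = evaluation at `0` is reduced and has cancellation,
`t` has value `0`, and no `u · tⁿ` with `u(0) ≠ 0` vanishes. [folklore] -/
theorem polynomial_model :
    ∃ (R : Type) (_ : CommRing R) (ev : R →+* ℚ) (x : R), Function.Surjective ev ∧ IsReduced R ∧
      (∀ u y : R, ev u ≠ 0 → u * y = 0 → y = 0) ∧ ev x = 0 ∧ x ≠ 0 ∧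
      ¬ (∃ u : R, ev u ≠ 0 ∧ ∃ n : ℕ, u * x ^ n = 0) := by
  refine ⟨Polynomial ℚ, inferInstance, Polynomial.evalRingHom 0, Polynomial.X, ?_, inferInstance,
    ?_, by simp, Polynomial.X_ne_zero, ?_⟩
  · intro q
    exact ⟨Polynomial.C q, by simp⟩
  · intro u y hu huy
    have hu0 : u ≠ 0 := fun h => hu (by rw [h, map_zero])
    exact (mul_eq_zero.mp huy).resolve_left hu0
  · rintro ⟨u, hu, n, hn⟩
    have hu0 : u ≠ 0 := fun h => hu (by rw [h, map_zero])
    exact hu0 ((mul_eq_zero.mp hn).resolve_right (pow_ne_zero n Polynomial.X_ne_zero))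

/-- **CAN is load-bearing**: `ℚ × ℚ` with `ev = fst` is reduced and satisfies GEN (`(1,0)` kills
the kernel `0 × ℚ`), but `(1,0) · (0,1) = 0` with `(0,1) ≠ 0` of value `0`. [folklore] -/
theorem product_model :
    ∃ (R : Type) (_ : CommRing R) (ev : R →+* ℚ), Function.Surjective ev ∧ IsReduced R ∧
      (∀ x : R, ev x = 0 → ∃ u : R, ev u ≠ 0 ∧ ∃ n : ℕ, u * x ^ n = 0) ∧
      ∃ u x : R, ev u ≠ 0 ∧ ev x = 0 ∧ u * x = 0 ∧ x ≠ 0 := by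
  refine ⟨ℚ × ℚ, inferInstance, RingHom.fst ℚ ℚ, ?_, inferInstance, ?_, (1, 0), (0, 1), by simp,
    by simp, by simp, by simp⟩
  · intro q
    exact ⟨(q, 0), rfl⟩
  · intro x hx
    refine ⟨(1, 0), by simp, 1, ?_⟩
    have h1 : x.1 = 0 := hx
    ext <;> simp [h1]

/-- **RED is load-bearing**: the dual numbers `ℚ[ε]` with `ev` = standard part satisfy GEN
(every value-zero element squares to `0`) and CAN (elements of non-zero value are units), but are
not reduced. [folklore] -/
theorem dualNumber_model :
    ∃ (R : Type) (_ : CommRing R) (ev : R →+* ℚ), Function.Surjective ev ∧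
      (∀ x : R, ev x = 0 → ∃ u : R, ev u ≠ 0 ∧ ∃ n : ℕ, u * x ^ n = 0) ∧
      (∀ u y : R, ev u ≠ 0 → u * y = 0 → y = 0) ∧ ¬ IsReduced R := by
  refine ⟨DualNumber ℚ, inferInstance, (TrivSqZeroExt.fstHom ℚ ℚ ℚ).toRingHom, ?_, ?_, ?_, ?_⟩
  · intro q
    exact ⟨TrivSqZeroExt.inl q, by simp⟩
  · intro x hx
    refine ⟨1, by simp, 2, ?_⟩
    have hx' : x.fst = 0 := by simpa using hx
    have hxe : x = TrivSqZeroExt.inr x.snd := by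
      ext <;> simp [hx']
    rw [one_mul, pow_two, hxe]
    exact TrivSqZeroExt.inr_mul_inr ℚ x.snd x.snd
  · intro u y hu huy
    have hu' : u.fst ≠ 0 := by simpa using hu
    have hunit : IsUnit u := TrivSqZeroExt.isUnit_iff_isUnit_fst.mpr (isUnit_iff_ne_zero.mpr hu')
    exact hunit.mul_right_eq_zero.mp huy
  · intro hred
    have hnil : IsNilpotent (DualNumber.eps : DualNumber ℚ) :=
      ⟨2, by rw [pow_two]; exact DualNumber.eps_mul_eps⟩
    have h0 := hred.eq_zero _ hnil
    have := congrArg TrivSqZeroExt.snd h0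
    simp at this

end Summit.KontsevichZagierPeriods.KontsevichZagierPeriods.Cruxes.SectorComplement.StrategistR1
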